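import Literature.NumberTheory.EllipticCurves.EtaQuotientQExpansionProofs
import Summits.BirchSwinnertonDyer.BirchSwinnertonDyer.Theorems.EisensteinDepletionAtTwoStarEtaParityCore
import Mathlib.RingTheory.PowerSeries.Derivative
import Mathlib.RingTheory.PowerSeries.Expand
import HarnessLib

/-!
# Route `EisensteinDepletionAtTwo`, crux E1M `DepletedLambdaLawAtTwo` (stmt-BirchSwinnertonDyer-20341), line `star`:
# the FORMAL HALF of the `η`-parity lemma — `q d/dq log ∏_{n ≥ 1}(1 − q^{δn})` is (minus) the Lambert series
# of `σ` at the multiples of `δ`, additively in `η`-quotients, and mod `2` it is `θ_δ`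

Cell `bsd-rank2`, seat `bsd-rank2-eng-2` GEN 12; helper `--supports stmt-BirchSwinnertonDyer-20341` (the typed piece that
eng-2 GEN 11's `EisensteinDepletionAtTwoStarEtaParityCore` named as missing: "the formal dlog identity
`q·d/dq log ∏(1−q^{dn}) = −Σ_m dσ(m/d)q^m`").  HONEST FRAMING: formal power-series algebra in `ℤ⟦X⟧` and
`𝔽₂⟦X⟧`; nothing here reads an analytic rank, nothing here proves (★-SymbGlobal) / `StarGO2` / `StarOptB` / E1M; BSD
is not proved by any of this (PARTITION D-0054: none — r_an ≥ 2 axis S0, door T-r3₂).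

## What this serves

Planner bsd-rank2-p2 GEN 22's structure-at-`2` package for the research residual R1 of line `star`
(`run/shared/lean/pub/bsd-rank2/p2/g22/R1-placement.md` §8.10–8.12; now inside `stub_starGO2` = generalized Ogg at
`2`) rests on the **`η`-parity lemma**: at an odd squarefree level `N`, for a modular unit `g = ∏_{δ ∣ N} η(δτ)^{r_δ}`,
the cuspidal `2`-torsion class `[½ div g]` is multiplicative at `2` iff every `r_δ` is even.  Its proof has three
steps: (arithmetic) `[½ div g]` multiplicative at `2` iff `ḡ` is a square on `X₀(N)_{𝔽₂}`; (function field) `ḡ` is a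
square iff `dḡ = 0`, i.e. iff `q ḡ'/ḡ = 0` (a constant, if the `q`-power prefactor `q^{Σδr_δ/24}` is split off);
(FORMAL) with `g = q^{e} · ∏_δ F_δ(q)^{r_δ}`, `F_δ = ∏_{n ≥ 1}(1 − q^{δn})`,

  `q g'/g = e + Σ_δ r_δ · q F_δ'/F_δ`,   `q F_δ'/F_δ = −Σ_{n ≥ 1} δn q^{δn}/(1 − q^{δn}) = −Σ_m δ σ(m/δ) [δ ∣ m] q^m`,

and mod `2`, for odd `δ`, `Σ_m δσ(m/δ)[δ ∣ m] q^m ≡ θ_δ := Σ_{k ≥ 1}(q^{δk²} + q^{2δk²})` (`σ(n)` odd iff `n = k²` or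
`2k²`), whose independence over `𝔽₂` for distinct odd squarefree `δ` is GEN 11's `sum_smul_theta_eq_C_iff`.  THIS FILE
PROVES THE FORMAL STEP end to end, in the vocabulary of `Literature.….EtaQuotientQExpansionProofs`
(`formalEulerPow 1 = ∏_{n ≥ 1}(1 − Xⁿ)`, `formalEulerScaled δ = ∏_{n ≥ 1}(1 − X^{δn}) ∈ ℤ⟦X⟧`) and Mathlib's
`PowerSeries.derivative` / `PowerSeries.expand`:

* `X_mul_derivative_eulerTrunc_one` / **`X_mul_derivative_formalEulerPow_one`** — `X·F' = −F·Σ_m σ(m) Xᵐ` for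
  `F = ∏_{n ≥ 1}(1 − Xⁿ)` (division-free Lambert pieces `(1 − Xⁿ)·(n Σ_{k ≥ 1} X^{nk}) = n Xⁿ`, induction on the
  truncated products, then coefficientwise);
* `formalEulerScaled_eq_expand`, **`X_mul_derivative_formalEulerScaled`** — `X·F_δ' = −F_δ·Σ_m δσ(m/δ)[δ ∣ m]Xᵐ`
  (chain rule `derivative_subst` for `X ↦ X^δ`);
* `X_mul_derivative_prod_zpow_mul_inv` — the logarithmic derivative `u ↦ X u'/u` is a homomorphism
  `(ℤ⟦X⟧)ˣ → ℤ⟦X⟧` (integer exponents), whence **`X_mul_derivative_prod_formalEulerScaled_zpow`**: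
  `X·u' = −u·Σ_δ r_δ Σ_m δσ(m/δ)[δ ∣ m]Xᵐ` for `u = ∏_δ F_δ^{r_δ}`, `r_δ ∈ ℤ`;
* `map_zmod_two_lambertSigma` (odd `δ`: the Lambert series reduces to `θ_δ`),
  `map_zmod_two_X_mul_derivative_prod_formalEulerScaled_zpow`, and **`etaParity_formal`**: for `D` a finite set of
  odd squarefree numbers, `X ū'` is a constant multiple of `ū` in `𝔽₂⟦X⟧` iff every `r_δ` (`δ ∈ D`) is even;
* §6 (appended): `isSquare_iff_derivative_eq_zero` (in `𝔽₂⟦X⟧`, `φ` is a square iff `φ' = 0`, via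
  `MvPowerSeries.map_frobenius_expand`) and the FINAL FORM
  **`isSquare_map_zmod_two_prod_formalEulerScaled_zpow_iff`**: `ū` is a square in `𝔽₂⟦X⟧` iff every `r_δ` is even.

The arithmetic step and the passage `𝔽₂(X₀(N)) ↪ 𝔽₂((q))` are NOT formalised (no `X₀(N)_{𝔽₂}` in the tree).
References: T. M. Apostol, *Modular functions and Dirichlet series in number theory*, GTM 41, §3.1 (`η` as a
`q`-product); the identity `q d/dq log ∏_{n ≥ 1}(1 − qⁿ) = −Σ_{n ≥ 1} σ(n)qⁿ` (equivalently `24 q η'/η = E₂`) is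
folklore; R. Honsberger, *Mathematical Gems I*, Ch. 10 Ex. 4 (parity of `σ`), tree
`Literature.NumberTheory.Multiplicative.SigmaParity` (eng-2 GEN 11).
-/

set_option linter.dupNamespace false
set_option autoImplicit false

open Finset ArithmeticFunction PowerSeries
open scoped ArithmeticFunction.sigma

namespace Summit.BirchSwinnertonDyer.BirchSwinnertonDyer.Theorems.DepletionAtTwo

open Literature.NumberTheory.EllipticCurves.ModularForms

/-! ### 1. The Lambert pieces `n·Σ_{k ≥ 1} X^{nk}` -/

/-- `(1 − Xⁿ) · (n Σ_{k ≥ 1} X^{nk}) = n Xⁿ` in `ℤ⟦X⟧` (`n ≥ 1`): the Lambert piece `n Xⁿ/(1 − Xⁿ)` without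
division. [folklore] -/
theorem one_sub_X_pow_mul_lambertPiece {n : ℕ} (hn : n ≠ 0) :
    (1 - (X : PowerSeries ℤ) ^ n) * PowerSeries.mk (fun m ↦ if n ∣ m ∧ m ≠ 0 then (n : ℤ) else 0) =
      C (n : ℤ) * X ^ n := by
  ext m
  rw [sub_mul, one_mul, map_sub, coeff_X_pow_mul', coeff_C_mul, coeff_X_pow]
  simp only [coeff_mk]
  by_cases hmn : m = n
  · subst hmn
    simp [hn]
  rw [if_neg hmn, mul_zero]
  by_cases h1 : n ∣ m ∧ m ≠ 0
  · have hle : n ≤ m := Nat.le_of_dvd (Nat.pos_of_ne_zero h1.2) h1.1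
    have hsub : n ∣ m - n ∧ m - n ≠ 0 := ⟨Nat.dvd_sub h1.1 dvd_rfl, by omega⟩
    rw [if_pos h1, if_pos hle, if_pos hsub, sub_self]
  · rw [if_neg h1, zero_sub, neg_eq_zero]
    by_cases hle : n ≤ m
    · rw [if_pos hle, if_neg]
      rintro ⟨h4, h5⟩
      refine h1 ⟨?_, by omega⟩
      have := Nat.dvd_add h4 (dvd_refl n)
      rwa [Nat.sub_add_cancel hle] at this
    · rw [if_neg hle]

/-- Coefficients of the partial Lambert sum `Σ_{n=1}^{N} n Σ_{k ≥ 1} X^{nk}`: for `m ≤ N` the `m`-th coefficient is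
`σ(m) = Σ_{n ∣ m} n` (all divisors of `m` are `≤ m ≤ N`; `σ(0) = 0`). [folklore] -/
theorem coeff_sum_lambertPiece {m N : ℕ} (hmN : m ≤ N) :
    coeff m (∑ n ∈ Finset.range N,
      PowerSeries.mk (fun m ↦ if (n + 1) ∣ m ∧ m ≠ 0 then ((n + 1 : ℕ) : ℤ) else 0)) = (σ 1 m : ℤ) := by
  rw [map_sum]
  simp only [coeff_mk]
  rcases Nat.eq_zero_or_pos m with rfl | hm
  · simp
  rw [sigma_one_apply, Nat.cast_sum]
  -- reindex `n ↦ n + 1 : range N → Icc 1 N`, then the support is the set of divisors of `m`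
  rw [Finset.range_eq_Ico,
    Finset.sum_Ico_add' (fun d ↦ if d ∣ m ∧ m ≠ 0 then ((d : ℕ) : ℤ) else 0) 0 N 1, ← Finset.sum_filter]
  refine Finset.sum_congr ?_ fun _ _ ↦ rfl
  ext d
  simp only [Finset.mem_filter, Finset.mem_Ico, Nat.mem_divisors, zero_add]
  constructor
  · rintro ⟨-, hd, -⟩; exact ⟨hd, hm.ne'⟩
  · rintro ⟨hd, -⟩
    have := Nat.le_of_dvd hm hd
    have := Nat.pos_of_dvd_of_pos hd hm
    exact ⟨⟨by omega, by omega⟩, hd, hm.ne'⟩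

/-! ### 2. The logarithmic derivative of the truncated and of the full Euler product -/

/-- `d/dX (1 − X^{n+1}) = −(n+1) Xⁿ`. [folklore] -/
theorem derivative_one_sub_X_pow_succ (n : ℕ) :
    d⁄dX ℤ (1 - (X : PowerSeries ℤ) ^ (n + 1)) = -(C ((n + 1 : ℕ) : ℤ) * X ^ n) := by
  rw [map_sub, Derivation.map_one_eq_zero, zero_sub, derivative_pow, derivative_X, mul_one,
    Nat.add_sub_cancel, map_natCast]

/-- **Logarithmic derivative of the truncated Euler product**: for `E_N = ∏_{n=1}^{N} (1 − Xⁿ)`,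
`X · E_N' = −E_N · Σ_{n=1}^{N} n Xⁿ/(1 − Xⁿ)` (division-free: the Lambert pieces are the series
`n Σ_{k ≥ 1} X^{nk}`). [folklore] -/
theorem X_mul_derivative_eulerTrunc_one (N : ℕ) :
    X * d⁄dX ℤ (eulerTrunc 1 N) = -(eulerTrunc 1 N * ∑ n ∈ Finset.range N,
      PowerSeries.mk (fun m ↦ if (n + 1) ∣ m ∧ m ≠ 0 then ((n + 1 : ℕ) : ℤ) else 0)) := by
  induction N with
  | zero => simp [eulerTrunc]
  | succ N ih =>
    rw [eulerTrunc, Finset.prod_range_succ, ← eulerTrunc, pow_one, Finset.sum_range_succ]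
    have hleib := (d⁄dX ℤ).leibniz (eulerTrunc 1 N) (1 - X ^ (N + 1))
    rw [smul_eq_mul, smul_eq_mul] at hleib
    have hT := derivative_one_sub_X_pow_succ N
    have hH := one_sub_X_pow_mul_lambertPiece (n := N + 1) (Nat.succ_ne_zero N)
    linear_combination (X : PowerSeries ℤ) * hleib + X * eulerTrunc 1 N * hT +
      (1 - X ^ (N + 1)) * ih + eulerTrunc 1 N * hH

/-- **Logarithmic derivative of the Euler product `∏_{n ≥ 1} (1 − Xⁿ) ∈ ℤ⟦X⟧`**:
`X · F' = −F · Σ_{m ≥ 1} σ(m) Xᵐ` — i.e. `X F'/F = −Σ_{n ≥ 1} n Xⁿ/(1 − Xⁿ) = −Σ_m σ(m) Xᵐ`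
(coefficientwise from the truncated identity: degree-`k` coefficients only see `∏_{n ≤ k}`).
[folklore] -/
theorem X_mul_derivative_formalEulerPow_one :
    X * d⁄dX ℤ (formalEulerPow 1) = -(formalEulerPow 1 * PowerSeries.mk fun m ↦ (σ 1 m : ℤ)) := by
  ext k
  rcases k with _ | k
  · simp [PowerSeries.coeff_mul]
  · have h := congr_arg (coeff (k + 1)) (X_mul_derivative_eulerTrunc_one (k + 1))
    rw [coeff_succ_X_mul, coeff_derivative, map_neg, PowerSeries.coeff_mul] at h
    rw [coeff_succ_X_mul, coeff_derivative, map_neg, PowerSeries.coeff_mul,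
      coeff_formalEulerPow (le_refl (k + 1)), h]
    congr 1
    refine Finset.sum_congr rfl fun ij hij ↦ ?_
    rw [coeff_formalEulerPow (Finset.HasAntidiagonal.antidiagonal.fst_le hij),
      coeff_sum_lambertPiece (Finset.HasAntidiagonal.antidiagonal.snd_le hij),
      coeff_mk]

/-! ### 3. The scaled products `∏_{n ≥ 1} (1 − X^{δ n})` (`formalEulerScaled δ = expand δ (formalEulerPow 1)`) -/

/-- `formalEulerScaled δ` is Mathlib's `expand δ` of `formalEulerPow 1` (`X ↦ X^δ`). [folklore] -/
theorem formalEulerScaled_eq_expand {δ : ℕ} (hδ : δ ≠ 0) :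
    formalEulerScaled δ = expand δ hδ (formalEulerPow 1) := by
  ext m
  rw [coeff_formalEulerScaled, coeff_expand]

/-- The Lambert series of `σ` at the multiples of `δ`, `Σ_m δ σ(m/δ) [δ ∣ m] Xᵐ = δ · (Σ_j σ(j) X^j)(X^δ)`.
[folklore] -/
theorem lambertSigma_eq_C_mul_expand {δ : ℕ} (hδ : δ ≠ 0) :
    (PowerSeries.mk fun m ↦ if δ ∣ m then ((δ * σ 1 (m / δ) : ℕ) : ℤ) else 0) =
      C (δ : ℤ) * expand δ hδ (PowerSeries.mk fun m ↦ (σ 1 m : ℤ)) := by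
  ext m
  rw [coeff_mk, coeff_C_mul, coeff_expand]
  split_ifs with h
  · rw [coeff_mk, Nat.cast_mul]
  · rw [mul_zero]

/-- **Logarithmic derivative of `∏_{n ≥ 1} (1 − X^{δn}) ∈ ℤ⟦X⟧`** (`δ ≥ 1`):
`X · F_δ' = −F_δ · Σ_m δ σ(m/δ) [δ ∣ m] Xᵐ`, i.e. `X F_δ'/F_δ = −Σ_{n ≥ 1} δn X^{δn}/(1 − X^{δn})` — the
`q d/dq log` of the `q`-product part of `η(δτ)` (chain rule `X ↦ X^δ` on `X_mul_derivative_formalEulerPow_one`).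
[folklore] -/
theorem X_mul_derivative_formalEulerScaled {δ : ℕ} (hδ : δ ≠ 0) :
    X * d⁄dX ℤ (formalEulerScaled δ) =
      -(formalEulerScaled δ * PowerSeries.mk fun m ↦ if δ ∣ m then ((δ * σ 1 (m / δ) : ℕ) : ℤ) else 0) := by
  have hexp := congr_arg (expand δ hδ) X_mul_derivative_formalEulerPow_one
  rw [map_mul, expand_X, map_neg, map_mul] at hexp
  have hX : (X : PowerSeries ℤ) * X ^ (δ - 1) = X ^ δ := by
    rw [← pow_succ', Nat.sub_add_cancel (Nat.pos_of_ne_zero hδ)]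
  have hC : ((δ : ℕ) : PowerSeries ℤ) = C (δ : ℤ) := (map_natCast C δ).symm
  rw [lambertSigma_eq_C_mul_expand hδ, formalEulerScaled_eq_expand hδ, expand_apply,
    derivative_subst ℤ (HasSubst.X_pow hδ), ← expand_apply δ hδ, ← expand_apply δ hδ, derivative_pow,
    derivative_X]
  linear_combination ((δ : ℕ) : PowerSeries ℤ) * hexp
    - (expand δ hδ (formalEulerPow 1) * expand δ hδ (PowerSeries.mk fun m ↦ (σ 1 m : ℤ))) * hC
    + ((δ : ℕ) : PowerSeries ℤ) * expand δ hδ (d⁄dX ℤ (formalEulerPow 1)) * hX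

/-! ### 4. Products `∏_δ F_δ^{r_δ}` with integer exponents: the logarithmic derivative is additive -/

/-- `∏_{n ≥ 1} (1 − X^{δn})` is a unit of `ℤ⟦X⟧` (constant term `1`). [folklore] -/
theorem isUnit_formalEulerScaled (δ : ℕ) : IsUnit (formalEulerScaled δ) := by
  rw [PowerSeries.isUnit_iff_constantCoeff, constantCoeff_formalEulerScaled]
  exact isUnit_one

/-- The logarithmic derivative `u ↦ X u'/u` is additive on units of `ℤ⟦X⟧`. [folklore] -/
theorem X_mul_derivative_mul_inv_mul (v w : (PowerSeries ℤ)ˣ) :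
    X * d⁄dX ℤ (v * w).val * (v * w)⁻¹.val =
      X * d⁄dX ℤ v.val * v⁻¹.val + X * d⁄dX ℤ w.val * w⁻¹.val := by
  rw [mul_inv_rev, Units.val_mul, Units.val_mul, (d⁄dX ℤ).leibniz, smul_eq_mul, smul_eq_mul]
  linear_combination (X * d⁄dX ℤ w.val * w⁻¹.val) * v.mul_inv + (X * d⁄dX ℤ v.val * v⁻¹.val) * w.mul_inv

/-- **The logarithmic derivative `u ↦ X u'/u` is a homomorphism `(ℤ⟦X⟧)ˣ → (ℤ⟦X⟧, +)`**: for units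
`u_i` and integer exponents `r_i`, `X (∏ u_i^{r_i})' / ∏ u_i^{r_i} = Σ r_i · X u_i'/u_i`. [folklore] -/
theorem X_mul_derivative_prod_zpow_mul_inv {ι : Type*} (s : Finset ι) (u : ι → (PowerSeries ℤ)ˣ)
    (r : ι → ℤ) :
    X * d⁄dX ℤ (∏ i ∈ s, u i ^ r i).val * (∏ i ∈ s, u i ^ r i)⁻¹.val =
      ∑ i ∈ s, (r i : PowerSeries ℤ) * (X * d⁄dX ℤ (u i).val * (u i)⁻¹.val) := by
  -- the logarithmic derivative as a monoid hom into `Multiplicative ℤ⟦X⟧`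
  let φ : (PowerSeries ℤ)ˣ →* Multiplicative (PowerSeries ℤ) :=
    { toFun := fun v ↦ Multiplicative.ofAdd (X * d⁄dX ℤ v.val * v⁻¹.val)
      map_one' := by
        rw [Units.val_one, Derivation.map_one_eq_zero, mul_zero, zero_mul, ofAdd_zero]
      map_mul' := fun v w ↦ by
        rw [← ofAdd_add, Multiplicative.ofAdd.apply_eq_iff_eq, X_mul_derivative_mul_inv_mul] }
  have hφ : ∀ v : (PowerSeries ℤ)ˣ, Multiplicative.toAdd (φ v) = X * d⁄dX ℤ v.val * v⁻¹.val :=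
    fun v ↦ rfl
  rw [← hφ, map_prod, toAdd_prod]
  refine Finset.sum_congr rfl fun i _ ↦ ?_
  rw [map_zpow, toAdd_zpow, hφ, zsmul_eq_mul]

/-- **`X · (∏_δ F_δ^{r_δ})' = −(∏_δ F_δ^{r_δ}) · Σ_δ r_δ Σ_m δσ(m/δ)[δ ∣ m] Xᵐ`** for the units
`F_δ = ∏_{n ≥ 1}(1 − X^{δn})` of `ℤ⟦X⟧` and INTEGER exponents `r_δ` (`δ ∈ D`, all `δ ≥ 1`) — the `q d/dq log`
of the `q`-product part `∏_δ ∏_n (1 − q^{δn})^{r_δ}` of an `η`-quotient `∏_δ η(δτ)^{r_δ}`. [folklore] -/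
theorem X_mul_derivative_prod_formalEulerScaled_zpow (D : Finset ℕ) (hD : ∀ δ ∈ D, δ ≠ 0) (r : ℕ → ℤ) :
    X * d⁄dX ℤ (∏ δ ∈ D, (isUnit_formalEulerScaled δ).unit ^ r δ).val =
      -((∏ δ ∈ D, (isUnit_formalEulerScaled δ).unit ^ r δ).val *
        ∑ δ ∈ D, (r δ : PowerSeries ℤ) *
          PowerSeries.mk fun m ↦ if δ ∣ m then ((δ * σ 1 (m / δ) : ℕ) : ℤ) else 0) := by
  set u : (PowerSeries ℤ)ˣ := ∏ δ ∈ D, (isUnit_formalEulerScaled δ).unit ^ r δ with hu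
  have h := X_mul_derivative_prod_zpow_mul_inv D (fun δ ↦ (isUnit_formalEulerScaled δ).unit) r
  rw [← hu] at h
  have hδ : ∀ δ ∈ D, X * d⁄dX ℤ (isUnit_formalEulerScaled δ).unit.val *
      (isUnit_formalEulerScaled δ).unit⁻¹.val =
        -(PowerSeries.mk fun m ↦ if δ ∣ m then ((δ * σ 1 (m / δ) : ℕ) : ℤ) else 0) := by
    intro δ hδD
    rw [IsUnit.unit_spec, X_mul_derivative_formalEulerScaled (hD δ hδD), neg_mul, mul_assoc,
      mul_left_comm, (isUnit_formalEulerScaled δ).mul_val_inv, mul_one]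
  rw [Finset.sum_congr rfl fun δ hδD ↦ by rw [hδ δ hδD]] at h
  calc X * d⁄dX ℤ u.val
      = X * d⁄dX ℤ u.val * u⁻¹.val * u.val := by rw [Units.inv_mul_cancel_right]
    _ = _ := by
        rw [h, Finset.sum_mul, Finset.mul_sum, ← Finset.sum_neg_distrib]
        exact Finset.sum_congr rfl fun δ _ ↦ by ring

/-! ### 5. Reduction mod `2`: the Lambert series of `σ` at odd `δ` becomes `θ_δ`, and the `η`-parity lemma -/

/-- **Mod `2`, the Lambert series `Σ_m δσ(m/δ)[δ ∣ m] Xᵐ` of an ODD `δ` is `θ_δ = Σ_{k ≥ 1}(X^{δk²} + X^{2δk²})`**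
(`σ(n)` is odd iff `n` is a square or twice a square: `indicator_sq_or_twice_sq_eq_sigma`).
[cite: Honsberger1973, Ch. 10, Ex. 4 (p. 59)] -/
theorem map_zmod_two_lambertSigma {δ : ℕ} (hδ : Odd δ) :
    PowerSeries.map (Int.castRingHom (ZMod 2))
        (PowerSeries.mk fun m ↦ if δ ∣ m then ((δ * σ 1 (m / δ) : ℕ) : ℤ) else 0) =
      PowerSeries.mk ({m | ∃ k, k ≠ 0 ∧ (m = δ * k ^ 2 ∨ m = 2 * (δ * k ^ 2))}.indicator (1 : ℕ → ZMod 2)) := by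
  ext m
  rw [coeff_map, coeff_mk, coeff_mk, indicator_sq_or_twice_sq_eq_sigma hδ m]
  by_cases hm : m = 0
  · subst hm
    simp
  · by_cases hdm : δ ∣ m
    · rw [if_pos hdm, if_pos ⟨hdm, hm⟩, eq_intCast, Int.cast_natCast]
    · rw [if_neg hdm, if_neg (fun h ↦ hdm h.1), eq_intCast, Int.cast_zero]

/-- **The `q d/dq log` of `∏_δ ∏_n (1 − q^{δn})^{r_δ}` mod `2`** (`D` a finite set of ODD `δ`, integer `r_δ`):
`X · ū' = −ū · Σ_{δ ∈ D} r̄_δ θ_δ` in `𝔽₂⟦X⟧`, `θ_δ = Σ_{k ≥ 1}(X^{δk²} + X^{2δk²})`. [folklore] -/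
theorem map_zmod_two_X_mul_derivative_prod_formalEulerScaled_zpow (D : Finset ℕ) (hD : ∀ δ ∈ D, Odd δ)
    (r : ℕ → ℤ) :
    PowerSeries.map (Int.castRingHom (ZMod 2))
        (X * d⁄dX ℤ (∏ δ ∈ D, (isUnit_formalEulerScaled δ).unit ^ r δ).val) =
      -(PowerSeries.map (Int.castRingHom (ZMod 2)) (∏ δ ∈ D, (isUnit_formalEulerScaled δ).unit ^ r δ).val *
        ∑ δ ∈ D, ((r δ : ℤ) : ZMod 2) •
          PowerSeries.mk ({m | ∃ k, k ≠ 0 ∧ (m = δ * k ^ 2 ∨ m = 2 * (δ * k ^ 2))}.indicator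
            (1 : ℕ → ZMod 2))) := by
  have hD0 : ∀ δ ∈ D, δ ≠ 0 := fun δ hδ h0 ↦ Nat.not_odd_zero (h0 ▸ hD δ hδ)
  rw [X_mul_derivative_prod_formalEulerScaled_zpow D hD0 r, map_neg, map_mul, map_sum]
  congr 2
  refine Finset.sum_congr rfl fun δ hδ ↦ ?_
  rw [map_mul, map_zmod_two_lambertSigma (hD δ hδ), map_intCast, smul_eq_C_mul, ← map_intCast
    (C (R := ZMod 2)) (r δ)]

/-- **The `η`-parity lemma, FORMAL HALF.**  Let `D` be a finite set of odd squarefree numbers, `r : D → ℤ`, and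
`u = ∏_{δ ∈ D} F_δ^{r_δ} ∈ (ℤ⟦X⟧)ˣ`, `F_δ = ∏_{n ≥ 1}(1 − X^{δn})` — the `q`-product part of the `η`-quotient
`g = ∏_δ η(δτ)^{r_δ} = q^{Σδr_δ/24} · u`.  Then, in `𝔽₂⟦X⟧`, **`X ū'` is a constant multiple of `ū` (equivalently
`q ḡ'/ḡ` is constant, the shape of "`ḡ` is a square up to a power of `q`") iff every `r_δ` is even** — by §4, the
mod-`2` Lambert reduction `map_zmod_two_lambertSigma` and the independence of the `θ_δ`
(`sum_smul_theta_eq_C_iff`, eng-2 GEN 11).  The function-field step ("`ū` is a square in `𝔽₂(X₀(N))` iff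
`dū = 0`") and the arithmetic step ("`[½ div u]` multiplicative at `2` iff `ū` is a square") of bsd-rank2-p2
GEN 22's `η`-parity lemma (R1-placement §8.10–8.11) are NOT formalised here. [folklore] -/
theorem etaParity_formal {D : Finset ℕ} (hD : ∀ δ ∈ D, Odd δ ∧ Squarefree δ) (r : ℕ → ℤ) :
    (∃ c : ZMod 2, PowerSeries.map (Int.castRingHom (ZMod 2))
        (X * d⁄dX ℤ (∏ δ ∈ D, (isUnit_formalEulerScaled δ).unit ^ r δ).val) =
      C c * PowerSeries.map (Int.castRingHom (ZMod 2))
        (∏ δ ∈ D, (isUnit_formalEulerScaled δ).unit ^ r δ).val) ↔ ∀ δ ∈ D, Even (r δ) := by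
  set u : (PowerSeries ℤ)ˣ := ∏ δ ∈ D, (isUnit_formalEulerScaled δ).unit ^ r δ with hu
  have hubar : IsUnit (PowerSeries.map (Int.castRingHom (ZMod 2)) u.val) :=
    u.isUnit.map (PowerSeries.map (Int.castRingHom (ZMod 2)))
  have key := map_zmod_two_X_mul_derivative_prod_formalEulerScaled_zpow D (fun δ hδ ↦ (hD δ hδ).1) r
  rw [← hu] at key
  rw [← sum_smul_theta_eq_C_iff hD r, key]
  constructor
  · rintro ⟨c, hc⟩
    refine ⟨-c, ?_⟩
    rw [neg_mul_eq_mul_neg, mul_comm] at hc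
    have := hubar.mul_right_cancel hc
    rw [map_neg, ← this, neg_neg]
  · rintro ⟨c, hc⟩
    exact ⟨-c, by rw [hc, map_neg, neg_mul_eq_mul_neg, mul_comm]⟩

/-! ### 6. Squares in `𝔽₂⟦X⟧`: `φ` is a square iff `φ' = 0`; the `η`-parity lemma in its final formal form -/

/-- In `𝔽₂⟦X⟧`, `ψ² = ψ(X²)` (Frobenius is the identity on `𝔽₂`; Mathlib `MvPowerSeries.map_frobenius_expand`).
[folklore] -/
theorem sq_eq_expand_two (ψ : PowerSeries (ZMod 2)) : ψ ^ 2 = expand 2 two_ne_zero ψ := by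
  have h := MvPowerSeries.map_frobenius_expand 2 two_ne_zero (f := ψ)
  rw [ZMod.frobenius_zmod, MvPowerSeries.map_id] at h
  exact h.symm

/-- The formal derivative commutes with coefficientwise ring maps. [folklore] -/
theorem map_derivative {R S : Type*} [CommRing R] [CommRing S] (f : R →+* S) (φ : PowerSeries R) :
    PowerSeries.map f (d⁄dX R φ) = d⁄dX S (PowerSeries.map f φ) := by
  ext n
  rw [coeff_map, coeff_derivative, coeff_derivative, coeff_map, map_mul, map_add, map_natCast, map_one]

/-- **In `𝔽₂⟦X⟧` a power series is a square iff its derivative vanishes** (iff it has no odd-degree terms: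
then `φ = ψ(X²) = ψ²` with `ψ = Σ φ_{2k} X^k`). The `q`-expansion form of "in a function field of characteristic `2`
over a perfect field, `u` is a square iff `du = 0`". [folklore] -/
theorem isSquare_iff_derivative_eq_zero (φ : PowerSeries (ZMod 2)) : IsSquare φ ↔ d⁄dX (ZMod 2) φ = 0 := by
  have h2 : ((2 : ℕ) : PowerSeries (ZMod 2)) = 0 := by
    rw [← map_natCast (C (R := ZMod 2)) 2, show ((2 : ℕ) : ZMod 2) = 0 from by decide, _root_.map_zero]
  constructor
  · rintro ⟨ψ, rfl⟩
    rw [← pow_two, derivative_pow, h2, zero_mul, zero_mul]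
  · intro h
    refine ⟨PowerSeries.mk fun k ↦ coeff (2 * k) φ, ?_⟩
    rw [← pow_two, sq_eq_expand_two]
    ext n
    rw [coeff_expand]
    split_ifs with hn
    · rw [coeff_mk, Nat.mul_div_cancel' hn]
    · -- odd `n = m + 1`: `coeff m φ' = (m+1)·φ_{m+1} = φ_n = 0`
      obtain ⟨m, rfl⟩ : ∃ m, n = m + 1 := ⟨n - 1, by omega⟩
      have hm := congr_arg (coeff m) h
      rw [coeff_derivative, _root_.map_zero, ← Nat.cast_succ,
        (ZMod.natCast_eq_one_iff_odd (n := m + 1)).mpr (Nat.odd_iff.mpr (Nat.two_dvd_ne_zero.mp hn)),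
        mul_one] at hm
      exact hm

/-- For `φ ∈ 𝔽₂⟦X⟧` with non-zero constant term (e.g. a unit): `X φ'` is a constant multiple of `φ` iff `φ' = 0`
(compare constant terms: `0 = c · φ₀` forces `c = 0`). [folklore] -/
theorem exists_X_mul_derivative_eq_C_mul_iff {φ : PowerSeries (ZMod 2)} (h0 : constantCoeff φ ≠ 0) :
    (∃ c : ZMod 2, X * d⁄dX (ZMod 2) φ = C c * φ) ↔ d⁄dX (ZMod 2) φ = 0 := by
  constructor
  · rintro ⟨c, hc⟩
    have h := congr_arg constantCoeff hc
    rw [map_mul, constantCoeff_X, zero_mul, map_mul, constantCoeff_C] at h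
    have hc0 : c = 0 := by
      by_contra hne
      exact h0 ((mul_eq_zero.mp h.symm).resolve_left hne)
    rw [hc0, _root_.map_zero, zero_mul] at hc
    ext n
    have := congr_arg (coeff (n + 1)) hc
    rwa [coeff_succ_X_mul, _root_.map_zero] at this
  · intro h
    exact ⟨0, by rw [h, mul_zero, _root_.map_zero, zero_mul]⟩

/-- **The `η`-parity lemma, final FORMAL form: the mod-`2` `q`-expansion `ū ∈ 𝔽₂⟦q⟧` of `u = ∏_{δ ∈ D} F_δ^{r_δ}`
(`F_δ = ∏_{n ≥ 1}(1 − q^{δn})`, `D` a finite set of odd squarefree numbers, `r_δ ∈ ℤ`) is a SQUARE iff every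
`r_δ` is even.**  (`⟸` is trivial; `⟹` is `etaParity_formal` + `isSquare_iff_derivative_eq_zero`: a square has
`ū' = 0`, so `X ū' = 0 = −ū Σ r̄_δ θ_δ`, `ū` is a unit, and the `θ_δ` are independent over `𝔽₂`.)  This is exactly
the input "`ḡ` is a square ⟺ all `r_δ` even" of bsd-rank2-p2 GEN 22's `η`-parity lemma at the level of
`q`-expansions; the passage from the function field `𝔽₂(X₀(N))` to `𝔽₂((q))` (q-expansion principle) and the
arithmetic step are not formalised here. [folklore] -/
theorem isSquare_map_zmod_two_prod_formalEulerScaled_zpow_iff {D : Finset ℕ}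
    (hD : ∀ δ ∈ D, Odd δ ∧ Squarefree δ) (r : ℕ → ℤ) :
    IsSquare (PowerSeries.map (Int.castRingHom (ZMod 2))
        (∏ δ ∈ D, (isUnit_formalEulerScaled δ).unit ^ r δ).val) ↔ ∀ δ ∈ D, Even (r δ) := by
  set u : (PowerSeries ℤ)ˣ := ∏ δ ∈ D, (isUnit_formalEulerScaled δ).unit ^ r δ with hu
  have h0 : constantCoeff (PowerSeries.map (Int.castRingHom (ZMod 2)) u.val) ≠ 0 := by
    have hunit : IsUnit (PowerSeries.map (Int.castRingHom (ZMod 2)) u.val) :=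
      u.isUnit.map (PowerSeries.map (Int.castRingHom (ZMod 2)))
    exact (PowerSeries.isUnit_iff_constantCoeff.mp hunit).ne_zero
  rw [isSquare_iff_derivative_eq_zero, ← exists_X_mul_derivative_eq_C_mul_iff h0, ← map_derivative,
    ← etaParity_formal hD r, ← hu]
  refine exists_congr fun c ↦ ?_
  rw [map_mul, map_X]

end Summit.BirchSwinnertonDyer.BirchSwinnertonDyer.Theorems.DepletionAtTwo
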